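import Summits.AtomisticToContinuum.HydrodynamicLimit.Theses.StiffCollisionalRelaxation
import Summits.AtomisticToContinuum.HydrodynamicLimit.Theorems.CollisionIsometryCLTMacroClosureInBand
import HarnessLib

/-!
# `EulerRelEntropyDock` (stmt-AtomisticToContinuum-17823) — the DOCK of route `StiffCollisionalRelaxation`, PROVED

`EulerRelEntropyDock := FastMomentRelaxation → CollisionalTransferLocality → AprioriBoundsInBand →
RelEntropyStability → SecondLawInProbability → HydrodynamicLimit` (route StiffCollisionalRelaxation, rev 5/6).

Proof: transfer of the landed macroscopic closure of the sibling route `CollisionIsometryCLT` on UNIFORM kinetic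
inputs, `MacroClosureLine.Barycentric.macroClosureInBand_proof : UniformDock.MacroClosureInBand`
(`= CollisionIsometryCLT.CollisionalTransferLocality → UniformDock.AprioriBoundsInBand →
UniformDock.FastMomentRelaxationInBand → HydrodynamicLimit`, file `CollisionIsometryCLTMacroClosureInBand.lean`,
proved outright from the two-scale barycentric relative-entropy engine, two-scale Clausius in mean, the two-scale
homogeneous block MGF, hard-sphere thermodynamics and Ruelle convexity). The three kinetic antecedents of the dock
feed it verbatim: `StiffCollisionalRelaxation.CollisionalTransferLocality` and
`CollisionIsometryCLT.CollisionalTransferLocality` are the same term (byte-identical bodies),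
`StiffCollisionalRelaxation.AprioriBoundsInBand` IS `UniformDock.AprioriBoundsInBand`
(`UniformDock.aprioriBoundsInBand_iff_stiff`, `Iff.rfl`), and the sibling's `∀ t` hinge `FastMomentRelaxation`
(stmt-9522) gives the uniform pre-shock hinge (`UniformDock.fmrInBand_of_stiff`). The two macroscopic antecedents
`RelEntropyStability` (stmt-9520) and `SecondLawInProbability` (stmt-9521) are NOT used: the engine carries its own
Gronwall bookkeeping and its own Clausius-in-mean (from Liouville invariance, the entropy inequality and the block
MGF), so the dock holds with those two hypotheses idle.
-/

namespace Summit.AtomisticToContinuum.HydrodynamicLimit.Theorems.MacroClosureLine.StiffDock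

open Summit.AtomisticToContinuum.HydrodynamicLimit.Theses
open Summit.AtomisticToContinuum.HydrodynamicLimit.Theorems.MacroClosureLine

/-- **The Stiff route's dock without its two macroscopic hypotheses**: the `∀ t` kinetic hinge (stmt-9522),
collisional transfer locality and the UNIFORM pre-shock a-priori bounds (stmt-17749) already give the
packing-guarded conjunct, by the sibling route's landed uniform macroscopic closure
`Barycentric.macroClosureInBand_proof`. [cite: Dafermos2005, Thm 5.2.1] [cite: Ruelle1969, §3.4] -/
theorem hydrodynamicLimit_of_stiffInputs
    (hF : StiffCollisionalRelaxation.FastMomentRelaxation)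
    (hC : StiffCollisionalRelaxation.CollisionalTransferLocality)
    (hA : StiffCollisionalRelaxation.AprioriBoundsInBand) : _root_.HydrodynamicLimit :=
  Barycentric.macroClosureInBand_proof hC (UniformDock.aprioriBoundsInBand_iff_stiff.2 hA)
    (UniformDock.fmrInBand_of_stiff hF)

/-- **`EulerRelEntropyDock` PROVED** (stmt-AtomisticToContinuum-17823, the deciding dock of route
`StiffCollisionalRelaxation`): `FastMomentRelaxation → CollisionalTransferLocality → AprioriBoundsInBand →
RelEntropyStability → SecondLawInProbability → HydrodynamicLimit`; the last two antecedents are idle.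
[cite: Dafermos2005, Thm 5.2.1] [cite: OllaVaradhanYau1993, §1] -/
theorem eulerRelEntropyDock_proof : StiffCollisionalRelaxation.EulerRelEntropyDock :=
  fun hF hC hA _ _ => hydrodynamicLimit_of_stiffInputs hF hC hA

end Summit.AtomisticToContinuum.HydrodynamicLimit.Theorems.MacroClosureLine.StiffDock
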